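import Summits.BirchSwinnertonDyer.BirchSwinnertonDyer.Theorems.EisensteinPrimesGoodLatticeBDPValueHalvesNoCarayol
import HarnessLib

/-!
# Keller–Yin Thm. 3.0.8 at the good lattice from TWO published BDP-side facts, both PRINT-FAITHFUL, plus L-μλ:
# no Castella–Hsieh existence, no Carayol, and CGLS Thm. 5.1.3 read WITH its standing hypothesis (disc)

Width seat `bsd-line-x1-p1-w4` (gen 10), cell `bsd-eis`, crux 2 `GoodLatticeBDPValue`
(stmt-BirchSwinnertonDyer-19032), line `halves` v22. HELPERS ONLY (`--supports`), input bookkeeping for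
the line's stub 1 (the seven-fact analytic bundle), composing three observations that are each pure logic
inside the tree:

* Carayol is idle (width seat w3 g7, `Theorems/EisensteinPrimesGoodLatticeBDPValueHalvesNoCarayol.lean`:
  `not_dvd_level_of_good`, `satisfiesHeegnerHypothesis_level_iff`, and the Carayol-free L-div
  `goodLatticeDivOnTree_of_cgls'`).
* Castella–Hsieh existence is idle (width seat w5 g2, `Theorems/EisensteinPrimesGoodLatticeBDPValueH1OfCGLS.lean`,
  there still with Carayol): the ∃-frame clause of the registered PUBLISHED fact
  `CastellaGrossiLeeSkinner2022.proofThm422_exists_isBDPLFunction_isTorsion_charIdeal_dvd` (CGLS 2022, proof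
  of Thm. 4.2.2 first half — conjunct 3 of stub 1, the source of L-div) gives the existence input H1 on H1's
  own binders. §1 below is that observation WITHOUT Carayol (`goodBDPExistsOnTree_of_proofThm422'`).
* **(this seat) CGLS Thm. 5.1.3 WITH (disc).** Conjunct 4 of stub 1, `thm513_exists_isBDPLFunction_valueAtOne`,
  carries the ARM-P scope flag `CGLS22-Thm513-disc` (module docstring of
  `CastellaGrossiLeeSkinner2022/IMC2DivisibilityAndBDPValueFrame.lean`): it quantifies over every imaginary
  quadratic `K` with (Heeg) + (spl), STRONGER than print (CGLS §2 stands under (disc): `D_K` odd, `≠ −3`;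
  BDP 2013 Assumption 5.12 (3)); the print-faithful twin is `thm513_exists_isBDPLFunction_valueAtOne_disc`.
  Every X1 consumer (`KellerYinHalves.goodBDPValueOnTree_of_cgls`, w3 g7's `goodBDPValueOnTree_of_cgls'`)
  has (disc) in scope as `_hodd _h3` and ignores it; §2 (`goodBDPValueOnTree_of_thm513disc'`) is the same
  proof fed by the faithful twin, Carayol-free.
* §3 `thm308_of_cgls422_of_thm513disc_of_muLambda`: `h308` (`KellerYin2024.thm308_imc2_bdpValue_goodLattice_OPEN`)
  from TWO published named facts — CGLS proof of 4.2.2 (first half) and CGLS Thm. 5.1.3 WITH (disc) — and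
  the one preprint statement L-μλ (`GoodLatticeMuLambdaOnTree`); compare
  `KellerYinHalves.thm308_of_cgls_of_muLambda` (FOUR PUB facts, the fourth stronger than print). §4 is the
  same with the scope-flagged fact of record (a corollary through the tree's bridge `…_disc_of_thm513`).

HONEST FRAMING: CONDITIONAL theorems; no named fact is DISCHARGED (two are shown idle, one is weakened to
its print-faithful form); no summit statement / BSD / IMC / Keller–Yin theorem is proved; 0 sorry.

References: [CastellaGrossiLeeSkinner2022] proof of Thm. 4.2.2 (TeX L2343–L2352), Thm. 4.1.2, Rem. 4.1.3,
Prop. 4.2.1, Thm. 2.1.1, Thm. 5.1.3 with §5.1.2 and §2 standing (disc) (L935); [BertoliniDarmonPrasanna2013]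
Thm. 5.13 with Assumption 5.12 (3); [DiamondShurman2005] Prop. 5.8.5, (8.44); [KellerYin2024] Thm. 3.0.8.
-/

-- `Summit.BirchSwinnertonDyer.BirchSwinnertonDyer.…`: the summit and its single sub-problem share a name (D-0017 layout).
set_option linter.dupNamespace false
set_option autoImplicit false

noncomputable section

open scoped Classical

open PowerSeries WeierstrassCurve NumberField IsDedekindDomain Field
  Literature.NumberTheory.EllipticCurves Literature.NumberTheory.EllipticCurves.ModularForms
  Literature.NumberTheory.QuadraticFields Literature.NumberTheory.EllipticCurves.Rank1Residual
  Literature.NumberTheory.EllipticCurves.Castella2018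
  Literature.NumberTheory.EllipticCurves.KellerYin2024
  Literature.NumberTheory.EllipticCurves.CastellaGrossiLeeSkinner2022
  Summit.BirchSwinnertonDyer.Rank1Residual.X11b.Halves
  Summit.BirchSwinnertonDyer.Rank1Residual
  Summit.BirchSwinnertonDyer.Rank1Residual.X1.KellerYinHalves
  Summit.BirchSwinnertonDyer.BirchSwinnertonDyer.Theorems.GoodLatticeBDPValueHalvesNoCarayol

namespace Summit.BirchSwinnertonDyer.BirchSwinnertonDyer.Theorems.GoodLatticeThm308OfPrint

/-! ## §1 H1 (existence of the BDP frame) from CGLS 2022, proof of Thm. 4.2.2 — no Castella–Hsieh, no Carayol -/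

/-- **H1 from the CGLS proof-of-4.2.2 fact, Carayol-free.** On the data of `h308` the BDP frame EXISTS with an
embedding datum inducing `v`: `p ∈ v` (`‖ι(p)‖ = p⁻¹ < 1`), an embedding datum `ι'` inducing `v` exists
(`X11b.exists_datum_forall_mem_iff`), `p ∤ N` and (Heeg) for the level `N` of `Dt` from the prime support of
`N` alone (`GoodLatticeBDPValueHalvesNoCarayol.not_dvd_level_of_good` / `satisfiesHeegnerHypothesis_level_iff`),
`p` splits in `K`; and the existence clause `∃ Ω_K Ω_p L, Ω_K ≠ 0 ∧ IsBDPLFunction …` of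
`proofThm422_exists_isBDPLFunction_isTorsion_charIdeal_dvd` (whose hypotheses `Red`, (disc), (h1), (Sel),
`p ∈ v̄ ≠ v` are all binders of H1) gives the frame; its torsion / divisibility clauses are discarded.
= w5 g2's `GoodLatticeBDPValueH1OfCGLS.goodBDPExistsOnTree_of_cgls` with the hypothesis `hC` deleted.
CONDITIONAL on the one named PUBLISHED fact.
[cite: CastellaGrossiLeeSkinner2022, proof of Thm. 4.2.2 (TeX L2343–L2352) with Thm. 2.1.1 (the frame `𝓛_E`)]
[cite: DiamondShurman2005, Prop. 5.8.5 and (8.44)] -/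
theorem goodBDPExistsOnTree_of_proofThm422'
    (hdiv : proofThm422_exists_isBDPLFunction_isTorsion_charIdeal_dvd)
    (W : WeierstrassCurve ℚ) [W.IsElliptic] [W.IsGloballyMinimal] (p : ℕ) [Fact p.Prime] :
    GoodBDPExistsOnTree W p := by
  intro hp hgood hred _han _hGL K _ _ hK hHN hHp hodd h3 hEK hSel ι v vbar hv hvbar hne κ hκ γ _
    N _ Dt H ιC P _hP
  have hp2 : p ≠ 2 := by omega
  -- `p ∈ v`
  have hpv : ((p : ℕ) : 𝓞 K) ∈ v.asIdeal := by
    rw [hv]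
    have h1 : ((((p : ℕ) : 𝓞 K) : K)) = (p : K) := by push_cast; rfl
    rw [h1, map_natCast, Padic.norm_p]
    exact inv_lt_one_of_one_lt₀ (by exact_mod_cast (Fact.out : p.Prime).one_lt)
  -- an embedding datum inducing `v`
  obtain ⟨ι₀⟩ := PadicAlgCl.nonempty_ringEquiv_complex p
  obtain ⟨ι', -, hι'⟩ := X11b.exists_datum_forall_mem_iff p ι₀ hK hpv
  -- the level has the prime support of the conductor: `p ∤ N` and (Heeg) for `N`
  have hpN : ¬ p ∣ N := not_dvd_level_of_good Dt.isNewformOf hgood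
  have hHeeg : SatisfiesHeegnerHypothesis N K :=
    (satisfiesHeegnerHypothesis_level_iff Dt.isNewformOf).mpr hHN
  have hsplit : ((Ideal.span {(p : ℤ)}).primesOver (𝓞 K)).ncard = 2 := hHp p Fact.out (dvd_refl p)
  -- the published frame (its torsion / divisibility clauses are not needed here)
  obtain ⟨ΩK, Ωp, L, hΩK, hL, -, -⟩ := hdiv ι' W K v vbar κ γ Dt.isNewformOf hp2 hpN hred hK hHeeg
    hsplit hodd h3 hEK hSel hι' hvbar hne hκ
  exact ⟨ι', hι', ΩK, Ωp, L, hΩK, hL⟩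

/-! ## §2 L-val from CGLS 2022 Thm. 5.1.3 read WITH the standing hypothesis (disc) — the print-faithful twin, Carayol-free -/

/-- **L-val from the print-faithful twin of CGLS Thm. 5.1.3, Carayol-free.** Verbatim the proof of
`GoodLatticeBDPValueHalvesNoCarayol.goodBDPValueOnTree_of_cgls'` (itself `KellerYinHalves.goodBDPValueOnTree_of_cgls`
minus Carayol), with the two (disc) binders `hodd : Odd (discr K)` and `h3 : discr K ≠ −3` — in scope on the
data of `h308` and unused there — now FED to the named fact `thm513_exists_isBDPLFunction_valueAtOne_disc`
(the corrected twin of the scope-flagged `thm513_exists_isBDPLFunction_valueAtOne`, flag `CGLS22-Thm513-disc`).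
Steps: `p ∤ N` and (Heeg) for `N` from the prime support of `N`, `p ∈ v`, the Galois re-reading
`ι_ℂ = w₀ ∘ τ` (`exists_involution_map_eq`), ONE frame `L₀` with its value at `𝟙`, value rigidity across
periods (`X11b.constantCoeff_eq_of_isBDPLFunction`), and `(log_{ω_E} τ_* P)² = (log_{ω_E} P)²`
(`sq_padicLogOmega_map_eq_of_selmerCorank_eq_one`). CONDITIONAL on the one named PUBLISHED fact.
[cite: CastellaGrossiLeeSkinner2022, Thm. 5.1.3 (TeX `thmpadicGZ`, L2463–L2471) with §5.1.2 and the standing (disc) of §2 (L935)]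
[cite: BertoliniDarmonPrasanna2013, Thm. 5.13 with Assumption 5.12 (3)] [cite: DiamondShurman2005, Prop. 5.8.5 and (8.44)] -/
theorem goodBDPValueOnTree_of_thm513disc' (hval : thm513_exists_isBDPLFunction_valueAtOne_disc)
    (W : WeierstrassCurve ℚ) [W.IsElliptic] [W.IsGloballyMinimal] (p : ℕ) [Fact p.Prime] :
    GoodBDPValueOnTree W p := by
  intro hp hgood _hred _han _hGL K _ _ hK hHN hHp hodd h3 _hEK hSel ι v vbar hv _hvbar _hne κ hκ γ _
    N _ Dt H ιC P hP ι' hι' ΩK Ωp L hΩK hL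
  have hp2 : p ≠ 2 := by omega
  -- the level has the prime support of the conductor: `p ∤ N` and (Heeg) for `N`
  have hpN : ¬ p ∣ N := not_dvd_level_of_good Dt.isNewformOf hgood
  have hHeeg : SatisfiesHeegnerHypothesis N K :=
    (satisfiesHeegnerHypothesis_level_iff Dt.isNewformOf).mpr hHN
  have hsplit : ((Ideal.span {(p : ℤ)}).primesOver (𝓞 K)).ncard = 2 := hHp p Fact.out (dvd_refl p)
  -- `p ∈ v`
  have hpv : ((p : ℕ) : 𝓞 K) ∈ v.asIdeal := by
    rw [hv]
    have h1 : ((((p : ℕ) : 𝓞 K) : K)) = (p : K) := by push_cast; rfl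
    rw [h1, map_natCast, Padic.norm_p]
    exact inv_lt_one_of_one_lt₀ (by exact_mod_cast (Fact.out : p.Prime).one_lt)
  -- the Galois re-reading of the datum through THE infinite place
  set w₀ : InfinitePlace K := Classical.arbitrary (InfinitePlace K)
  obtain ⟨τ, hτ, hP'⟩ := exists_involution_map_eq hK ιC w₀ Dt H hP
  -- the published frame at `τ_* P`, with its value at `𝟙` — (disc) supplied
  obtain ⟨ΩK₀, Ωp₀, L₀, hΩK₀, hL₀, u, hu⟩ := hval ι' W K v κ γ Dt H w₀ ι
    (WeierstrassCurve.Affine.Point.map τ.toRatAlgHom P) hp2 hpN hK hsplit hpv hι' hHeeg hodd h3 hκ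
    Fact.out hP' hv
  -- value rigidity across periods: equal constant terms
  have hΩp : ((Ωp : unrIntegers p) : ℂ_[p]) ≠ 0 := by
    rw [Ne, ZeroMemClass.coe_eq_zero]; exact Units.ne_zero Ωp
  have hΩp₀ : ((Ωp₀ : unrIntegers p) : ℂ_[p]) ≠ 0 := by
    rw [Ne, ZeroMemClass.coe_eq_zero]; exact Units.ne_zero Ωp₀
  have hcc : PowerSeries.constantCoeff L = PowerSeries.constantCoeff L₀ :=
    X11b.constantCoeff_eq_of_isBDPLFunction hp2 hK hκ Fact.out hΩK₀ hΩK hΩp₀ hΩp hL₀ hL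
  -- `(log τ_* P)² = (log P)²`
  have hlog := sq_padicLogOmega_map_eq_of_selmerCorank_eq_one W p ι hSel τ hτ P
  refine ⟨u, ?_⟩
  have hv0 := UnrSeries.eq_constantCoeff_of_hasValueAt_zero hu
  have h0 := UnrSeries.hasValueAt_zero L
  rw [hcc, ← hv0, hlog] at h0
  exact h0

/-! ## §3 `h308` from TWO published named facts (both print-faithful) and the one preprint statement L-μλ -/

/-- **`h308` ⇐ {CGLS proof of 4.2.2 (first half), CGLS Thm. 5.1.3 WITH (disc)} (both PUBLISHED, both faithful
to print) + L-μλ (Keller–Yin Thm. 1.5.1 + Thms. 2.2.1–2.2.3: THE preprint content).** `KellerYinHalves.thm308_of_halves`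
with H1 by §1 (no Castella–Hsieh, no Carayol), L-div by w3 g7's Carayol-free
`GoodLatticeBDPValueHalvesNoCarayol.goodLatticeDivOnTree_of_cgls'`, L-val by §2 (disc twin, no Carayol). Compare
`KellerYinHalves.thm308_of_cgls_of_muLambda` (the same conclusion from FOUR facts, one scope-flagged): on line
`halves` the BDP side of stub 1 is TWO named facts, not four. CONDITIONAL on the named inputs; nothing booked,
no label moves. [cite: KellerYin2024, Thm. 3.0.8 (IMC2), Thm. 1.5.1, Thms. 2.2.1–2.2.3]
[cite: CastellaGrossiLeeSkinner2022, proof of Thm. 4.2.2, Thm. 4.1.2, Rem. 4.1.3, Prop. 4.2.1, Thm. 5.1.3 with (disc)] -/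
theorem thm308_of_cgls422_of_thm513disc_of_muLambda
    (hdiv : proofThm422_exists_isBDPLFunction_isTorsion_charIdeal_dvd)
    (hval : thm513_exists_isBDPLFunction_valueAtOne_disc)
    (hml : ∀ (W : WeierstrassCurve ℚ) [W.IsElliptic] [W.IsGloballyMinimal] (p : ℕ) [Fact p.Prime],
      GoodLatticeMuLambdaOnTree W p) :
    thm308_imc2_bdpValue_goodLattice_OPEN :=
  thm308_of_halves (fun W _ _ p _ ↦ goodBDPExistsOnTree_of_proofThm422' hdiv W p)
    (fun W _ _ p _ ↦ goodLatticeDivOnTree_of_cgls' hdiv W p) hml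
    (fun W _ _ p _ ↦ goodBDPValueOnTree_of_thm513disc' hval W p)

/-! ## §4 The same with the fact of record (scope-flagged) — a corollary through the tree's bridge -/

/-- **`h308` ⇐ {CGLS proof of 4.2.2 (first half), CGLS Thm. 5.1.3 as registered} + L-μλ.** The declaration of
record `thm513_exists_isBDPLFunction_valueAtOne` (no (disc) binder — stronger than print) implies its disc
twin by the tree's bridge `thm513_exists_isBDPLFunction_valueAtOne_disc_of_thm513`, so §3 applies: this is
`KellerYinHalves.thm308_of_cgls_of_muLambda` with BOTH `hCH` (Castella–Hsieh) and `hC` (Carayol) deleted —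
the form a v23 skeleton keeping the registered fact names would call. CONDITIONAL; nothing booked.
[cite: KellerYin2024, Thm. 3.0.8 (IMC2)] [cite: CastellaGrossiLeeSkinner2022, proof of Thm. 4.2.2, Thm. 5.1.3] -/
theorem thm308_of_cgls422_of_thm513_of_muLambda
    (hdiv : proofThm422_exists_isBDPLFunction_isTorsion_charIdeal_dvd)
    (hval : thm513_exists_isBDPLFunction_valueAtOne)
    (hml : ∀ (W : WeierstrassCurve ℚ) [W.IsElliptic] [W.IsGloballyMinimal] (p : ℕ) [Fact p.Prime],
      GoodLatticeMuLambdaOnTree W p) :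
    thm308_imc2_bdpValue_goodLattice_OPEN :=
  thm308_of_cgls422_of_thm513disc_of_muLambda hdiv
    (thm513_exists_isBDPLFunction_valueAtOne_disc_of_thm513 hval) hml

end Summit.BirchSwinnertonDyer.BirchSwinnertonDyer.Theorems.GoodLatticeThm308OfPrint

end
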